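import Summits.HubbardSuperconductivity.HubbardLadder.Bounds.ThermalTrialOperatorStiffnessCeiling
import Summits.Ventures.CertifiedManyBodySolver.Observables.StiffnessThermalTorusLimitKinetic
import Summits.Ventures.CertifiedManyBodySolver.Observables.StiffnessTLOddMomentIdentificationTT
import HarnessLib

/-!
# The THERMAL odd-moment (Krylov-3) stiffness ceiling of the `t–t′` torus at fixed `λ`, and its local words
# (part 1 of 2 of «ROUTE T-B′» of cell `pub/hubbard-tc`; part 2 = `StiffnessThermalOddMomentHook.lean`)

HONEST FRAMING: ladder R1–R4 with certified numbers; no claim on H/H₀. Cell `pub/hubbard-tc` (MO-S3 ORDER → T_c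
back-end), seat `hubbard-tc-mod-2` (KT back-end; HOME/hubbard-tc-mod-2/KT-THERMAL-INTERFACE.md §3c). A one-sided
CEILING on the thermal flux stiffness (helicity modulus); not a superconductivity verdict, not a `T_c` of any material;
NO certificate and NO number lives in this file.

The tree holds (a) pub-hubbard's **thermal trial-operator (sharp Bogoliubov–Duhamel) stiffness ceiling**
`thermalStiffnessTT'_le_kin_sub_trialOperator` (for every Hermitian `C` on the sector space,
`ρ_s L² ≤ ½Re⟨K_p⟩ − μ‖⟨[C,J_p]⟩‖ + (μ²/2)Re⟨[C,[H_p,C]]⟩`, all real `μ`) and (b) hubbard-obs-p2's **local words of the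
ground-state odd-moment row** `R-K3-TL` for the `t–t′` torus (`StiffnessTLOddMomentLocalObsTT.lean`: `k₀ = kinBondObsTT t′`,
`d₁ = firstMomentObsTT t′ U` = local density of `[𝒥,[H,𝒥]]`, `m₃′ = thirdMomentObsTT t′ U` = local density of `[B,[H,B]]`,
`B = H𝒥 − 𝒥H`). This file composes them at `T > 0` with the canonical trial operator `C = i(H_pJ_p − J_pH_p)` (first
Liouvillian Krylov vector of the current; polarisation class):

* §1 `le_add_oddMoments_of_le_sub_duhamel` (ENGINE, any finite-dimensional Gibbs state): from
  `ρ ≤ G − (β/2)Re(J,J)_Duh`, for EVERY real `λ`, `ρ ≤ G + 2λ m₁ + λ² m₃` with the THERMAL odd moments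
  `m₁ = ½Re⟨[J,[H,J]]⟩_β ≥ 0`, `m₃ = −½Re⟨[B,[H,B]]⟩_β ≥ 0`; `thermalStiffnessTT'_mul_sq_le_kinetic_add_oddMoments` — the
  `t–t′` torus in any coordinate sector: `ρ_s L² ≤ ½Re⟨K_p⟩ + 2λ m₁ + λ² m₃`, the exact thermal twin of the ground-state
  ceiling `fluxStiffness_mul_sq_le_kinetic_add_oddMomentsTT` (same words, thermal expectations).
* §2 block bookkeeping (all operators conserve `N↑, N↓`, so sector blocks of products are products of blocks) and
  locality: for EVERY vector `ψ`, `⟨ψ,[𝒥,[H,𝒥]]ψ⟩ = L²·torusAvg(d₁)(ψ)` (`L ≥ 9`) and `⟨ψ,[B,[H,B]]ψ⟩ = L²·torusAvg(m₃′)(ψ)`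
  (`L ≥ 15`); the fixed-`λ` word `a_λ = ½Γk₀ + λΓd₁ − (λ²/2)m₃′` as ONE local observable on `[-7,7]²` with
  `Re ω(a_λ) = oddMomentLimitFunctionalTT t′ U λ ω` and the matching torus-average identity.

WHAT THIS IS NOT: no certificate; the trial-operator family never sees the energy-diagonal (Drude-type) part of the
Duhamel function, so the reach of this class is the regular (finite-frequency) optical weight, not zero stiffness.

References: DLS1978 §2 eqs. (22′), (27), (28); Lipparini2008 eqs. (8.30), (8.39) (`m₋₁ ≥ m₁²/m₃`); ScalapinoWhiteZhang1993
§II; HazraVermaRanderia2019 eq. (4); BratteliRobinsonII1997 Thm. 6.2.4; LiebPRL1989 Remark (2).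
-/

noncomputable section

namespace Summit.Ventures.CertifiedManyBodySolver.Observables

open Filter Topology Matrix Finset
open Literature.MathematicalPhysics.QuantumLattice
open Literature.MathematicalPhysics.QuantumLattice.ThermodynamicLimit
open Literature.MathematicalPhysics.QuantumFieldTheory
open Literature.MathematicalPhysics.StatisticalMechanics
open Literature.MathematicalPhysics.StatisticalMechanics.KosterlitzThouless
open Literature.Probability.LatticeModels
open scoped ComplexConjugate ComplexOrder

/-! ## §1 The thermal odd-moment ceiling at fixed `λ` (finite volume) -/

section Engine

variable {m : Type*} [Fintype m] [DecidableEq m]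

/-- **Engine (thermal odd-moment ceiling, any finite-dimensional Gibbs state).** For Hermitian `H, J`, `β ≥ 0`
and reals `ρ, G` with `ρ ≤ G − (β/2) Re (J,J)_Duh`: for EVERY real `λ`,
`ρ ≤ G + 2λ·m₁ + λ²·m₃` with `m₁ = ½Re⟨J(HJ−JH) − (HJ−JH)J⟩_β` (`= ½Re⟨[J,[H,J]]⟩ ≥ 0`) and
`m₃ = −½Re⟨B(HB−BH) − (HB−BH)B⟩_β`, `B = HJ − JH` (`= −½Re⟨[B,[H,B]]⟩ ≥ 0`). Proof: the sharp Bogoliubov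
trial-operator ceiling `le_sub_trialOperator_of_le_sub_duhamel` with the Hermitian trial operator `C = i·B`:
`‖⟨[C,J]⟩‖ = ‖⟨[J,[H,J]]⟩‖ ≥ 2m₁` and `Re⟨[C,[H,C]]⟩ = 2m₃`; `μ = −λ` for `λ ≤ 0`, `μ = 0` for `λ ≥ 0`.
[cite: DLS1978, §2 eqs. (22'), (27), (28)] [cite: Lipparini2008, eq. (8.30)] -/
theorem le_add_oddMoments_of_le_sub_duhamel {H J : Matrix m m ℂ} (hH : H.IsHermitian) (hJ : J.IsHermitian)
    {β ρ G : ℝ} (hβ : 0 ≤ β) (h : ρ ≤ G - β / 2 * (duhamel β H J J).re) (lam : ℝ) :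
    ρ ≤ G + 2 * lam * ((gibbsState β H (J * (H * J - J * H) - (H * J - J * H) * J)).re / 2) +
        lam ^ 2 * (-(gibbsState β H ((H * J - J * H) * (H * (H * J - J * H) - (H * J - J * H) * H) -
          (H * (H * J - J * H) - (H * J - J * H) * H) * (H * J - J * H))).re / 2) ∧
      0 ≤ (gibbsState β H (J * (H * J - J * H) - (H * J - J * H) * J)).re / 2 ∧
      0 ≤ -(gibbsState β H ((H * J - J * H) * (H * (H * J - J * H) - (H * J - J * H) * H) -
          (H * (H * J - J * H) - (H * J - J * H) * H) * (H * J - J * H))).re / 2 := by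
  -- the anti-Hermitian first Krylov vector `B = HJ − JH` and the Hermitian trial operator `C = i B`
  have hBa : (H * J - J * H)ᴴ = -(H * J - J * H) := by
    rw [conjTranspose_sub, conjTranspose_mul, conjTranspose_mul, hH.eq, hJ.eq, neg_sub]
  have hC : (Complex.I • (H * J - J * H)).IsHermitian := by
    unfold Matrix.IsHermitian
    rw [conjTranspose_smul, hBa, Complex.star_def, Complex.conj_I, smul_neg, neg_smul, neg_neg]
  obtain ⟨h1, -, h3⟩ := Summit.HubbardSuperconductivity.HubbardLadder.Bounds.le_sub_trialOperator_of_le_sub_duhamel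
    hH hJ hC hβ h
  -- `[C, J] = -i [J,[H,J]]`
  have e1 : Complex.I • (H * J - J * H) * J - J * (Complex.I • (H * J - J * H)) =
      (-Complex.I) • (J * (H * J - J * H) - (H * J - J * H) * J) := by
    rw [smul_mul_assoc, mul_smul_comm, ← smul_sub, neg_smul, ← smul_neg, neg_sub]
  have hnorm : ‖gibbsState β H (Complex.I • (H * J - J * H) * J - J * (Complex.I • (H * J - J * H)))‖ =
      ‖gibbsState β H (J * (H * J - J * H) - (H * J - J * H) * J)‖ := by
    rw [e1, map_smul, smul_eq_mul, norm_mul, norm_neg, Complex.norm_I, one_mul]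
  -- `[C,[H,C]] = -[B,[H,B]]`
  have e2 : Complex.I • (H * J - J * H) * (H * (Complex.I • (H * J - J * H)) - Complex.I • (H * J - J * H) * H) -
        (H * (Complex.I • (H * J - J * H)) - Complex.I • (H * J - J * H) * H) * (Complex.I • (H * J - J * H)) =
      -((H * J - J * H) * (H * (H * J - J * H) - (H * J - J * H) * H) -
          (H * (H * J - J * H) - (H * J - J * H) * H) * (H * J - J * H)) := by
    simp only [smul_mul_assoc, mul_smul_comm, ← smul_sub, smul_smul, Complex.I_mul_I, neg_smul, one_smul]
    abel
  have hre3 : (gibbsState β H (Complex.I • (H * J - J * H) *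
        (H * (Complex.I • (H * J - J * H)) - Complex.I • (H * J - J * H) * H) -
        (H * (Complex.I • (H * J - J * H)) - Complex.I • (H * J - J * H) * H) * (Complex.I • (H * J - J * H)))).re =
      -(gibbsState β H ((H * J - J * H) * (H * (H * J - J * H) - (H * J - J * H) * H) -
          (H * (H * J - J * H) - (H * J - J * H) * H) * (H * J - J * H))).re := by
    rw [e2, map_neg, Complex.neg_re]
  -- positivity of both moments
  have hm1 : 0 ≤ (gibbsState β H (J * (H * J - J * H) - (H * J - J * H) * J)).re :=
    hH.re_gibbsState_doubleComm_nonneg hJ hβ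
  have hm3 : 0 ≤ -(gibbsState β H ((H * J - J * H) * (H * (H * J - J * H) - (H * J - J * H) * H) -
      (H * (H * J - J * H) - (H * J - J * H) * H) * (H * J - J * H))).re := by
    rw [← hre3]; exact h3
  refine ⟨?_, by linarith, by linarith⟩
  -- `‖⟨[J,[H,J]]⟩‖ ≥ Re⟨[J,[H,J]]⟩`
  have hReLe : (gibbsState β H (J * (H * J - J * H) - (H * J - J * H) * J)).re ≤
      ‖gibbsState β H (J * (H * J - J * H) - (H * J - J * H) * J)‖ := Complex.re_le_norm _
  rcases le_or_gt lam 0 with hlam | hlam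
  · have h1' := h1 (-lam)
    rw [hnorm, hre3] at h1'
    nlinarith [mul_le_mul_of_nonpos_left hReLe hlam]
  · have h1' := h1 0
    rw [zero_mul, sub_zero] at h1'
    nlinarith [sq_nonneg lam]

end Engine

section Torus

variable {L : ℕ} [NeZero L]

/-- pub-hubbard's Summits-side current operator and hubbard-obs's Literature-layer one are the same matrix
(identical definitions). [cite: ScalapinoWhiteZhang1993, §II] -/
theorem bounds_curOpTT'_eq (t' : ℝ) :
    Summit.HubbardSuperconductivity.HubbardLadder.Bounds.curOpTT' L t' = curOpTT' L t' := rfl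

/-- **Thermal odd-moment (Krylov-3) stiffness ceiling for the `t–t′` torus, every real `λ`** (`L ≥ 3`, every
`t′, U`, `β > 0`, `θ₀ > 0`, every coordinate sector `p`, every `ρ_s` with `β ρ_s θ² ≤ log Z_p(0) − log Z_p(θ)` on
`|θ| ≤ θ₀`): with `H_p, K_p, J_p` the sector blocks of `hubbardTorusTT' L 1 t′ U`, `kinOpTT' L t′`, `curOpTT' L t′`,
`B_p = H_pJ_p − J_pH_p` and `⟨·⟩` the sector Gibbs state,
`ρ_s L² ≤ ½Re⟨K_p⟩ + 2λ·(½Re⟨J_p(H_pJ_p−J_pH_p) − (H_pJ_p−J_pH_p)J_p⟩) + λ²·(−½Re⟨B_p(H_pB_p−B_pH_p) − (H_pB_p−B_pH_p)B_p⟩)`,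
and both moments are `≥ 0` — the thermal twin of `fluxStiffness_mul_sq_le_kinetic_add_oddMomentsTT`.
[cite: DLS1978, §2 eqs. (22'), (27), (28)] [cite: Lipparini2008, eq. (8.30)] [cite: ScalapinoWhiteZhang1993, §II] -/
theorem thermalStiffnessTT'_mul_sq_le_kinetic_add_oddMoments (hL : 3 ≤ L) (t' U : ℝ) {β ρs θ₀ : ℝ}
    (hβ : 0 < β) (hθ₀ : 0 < θ₀) (p : Finset (Orb (FermionTorus 2 L)) → Prop)
    [Fintype {a // p a}] [DecidableEq {a // p a}]
    (hstiff : ∀ θ : ℝ, |θ| ≤ θ₀ → β * ρs * θ ^ 2 ≤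
        Real.log (partitionFn β ((hubbardTorusTT'Flux L t' U 0).toBlock p p)).re -
          Real.log (partitionFn β ((hubbardTorusTT'Flux L t' U θ).toBlock p p)).re) (lam : ℝ) :
    let Hp := (hubbardTorusTT' L 1 t' U).toBlock p p
    let Kp := (kinOpTT' L t').toBlock p p
    let Jp := (curOpTT' L t').toBlock p p
    ρs * (L : ℝ) ^ 2 ≤ (gibbsState β Hp Kp).re / 2 +
        2 * lam * ((gibbsState β Hp (Jp * (Hp * Jp - Jp * Hp) - (Hp * Jp - Jp * Hp) * Jp)).re / 2) +
        lam ^ 2 * (-(gibbsState β Hp ((Hp * Jp - Jp * Hp) * (Hp * (Hp * Jp - Jp * Hp) - (Hp * Jp - Jp * Hp) * Hp) -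
          (Hp * (Hp * Jp - Jp * Hp) - (Hp * Jp - Jp * Hp) * Hp) * (Hp * Jp - Jp * Hp))).re / 2) ∧
      0 ≤ (gibbsState β Hp (Jp * (Hp * Jp - Jp * Hp) - (Hp * Jp - Jp * Hp) * Jp)).re / 2 ∧
      0 ≤ -(gibbsState β Hp ((Hp * Jp - Jp * Hp) * (Hp * (Hp * Jp - Jp * Hp) - (Hp * Jp - Jp * Hp) * Hp) -
          (Hp * (Hp * Jp - Jp * Hp) - (Hp * Jp - Jp * Hp) * Hp) * (Hp * Jp - Jp * Hp))).re / 2 := by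
  intro Hp Kp Jp
  have hHp : Hp.IsHermitian := (hubbardTorusTT'_isHermitian L 1 t' U).submatrix _
  have hJp : Jp.IsHermitian := (isHermitian_curOpTT' (L := L) t').submatrix _
  obtain ⟨h1, -⟩ := Summit.HubbardSuperconductivity.HubbardLadder.Bounds.thermalStiffnessTT'_le_kin_sub_duhamel
    hL t' U hβ hθ₀ p hstiff
  exact le_add_oddMoments_of_le_sub_duhamel hHp hJp hβ.le h1 lam

end Torus

/-! ## §2 Block bookkeeping: the moments are Gibbs expectations of translation sums of LOCAL words -/

section Blocks

variable {L : ℕ} [NeZero L]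

/-- `(A B)_p = A_p B_p` when the left factor has no entries from the block to its complement. [folklore] -/
theorem toBlock_mul_of_toBlock_compl_eq_zero {ι : Type*} [Fintype ι] (p : ι → Prop) [DecidablePred p]
    (A B : Matrix ι ι ℂ) (hA : A.toBlock p (fun a => ¬ p a) = 0) :
    (A * B).toBlock p p = A.toBlock p p * B.toBlock p p := by
  rw [Matrix.toBlock_mul_eq_add p p p A B, hA, Matrix.zero_mul, add_zero]

omit [NeZero L] in
/-- `(A − B)_p = A_p − B_p`. [folklore] -/
theorem toBlock_sub_self {ι : Type*} (p : ι → Prop) (A B : Matrix ι ι ℂ) :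
    (A - B).toBlock p p = A.toBlock p p - B.toBlock p p := rfl

omit [NeZero L] in
/-- A matrix conserving `N↑, N↓` has no entries from a joint sector to its complement, for any decidable
presentation `p` of the sector. [cite: LiebPRL1989, Remark (2)] -/
theorem toBlock_compl_eq_zero_of_preservesSectors_torus {M : Matrix (Finset (Orb (FermionTorus 2 L)))
      (Finset (Orb (FermionTorus 2 L))) ℂ} (hM : PreservesSectors M) {k l : ℕ}
    (p : Finset (Orb (FermionTorus 2 L)) → Prop) [DecidablePred p]
    (hp : ∀ s, p s ↔ (upPart s).card = k ∧ (downPart s).card = l) :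
    M.toBlock p (fun s => ¬ p s) = 0 := by
  ext a b
  rw [toBlock_apply, Matrix.zero_apply]
  by_contra h
  have h1 := hM a.1 b.1 h
  have ha := (hp a.1).1 a.2
  exact b.2 ((hp b.1).2 ⟨h1.1.symm.trans ha.1, h1.2.symm.trans ha.2⟩)

omit [NeZero L] in
/-- **The block double commutator is the double commutator of the blocks** when `X` and `A` conserve
`N↑, N↓` and `p` presents one joint sector: `(A(XA−AX) − (XA−AX)A)_p = A_p(X_pA_p−A_pX_p) − (X_pA_p−A_pX_p)A_p`.
[cite: LiebPRL1989, Remark (2)] -/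
theorem toBlock_doubleComm_eq_of_preservesSectors {X A : Matrix (Finset (Orb (FermionTorus 2 L)))
      (Finset (Orb (FermionTorus 2 L))) ℂ} (hX : PreservesSectors X) (hA : PreservesSectors A) {k l : ℕ}
    (p : Finset (Orb (FermionTorus 2 L)) → Prop) [DecidablePred p]
    (hp : ∀ s, p s ↔ (upPart s).card = k ∧ (downPart s).card = l) :
    (A * (X * A - A * X) - (X * A - A * X) * A).toBlock p p =
      A.toBlock p p * (X.toBlock p p * A.toBlock p p - A.toBlock p p * X.toBlock p p) -
        (X.toBlock p p * A.toBlock p p - A.toBlock p p * X.toBlock p p) * A.toBlock p p := by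
  have hA0 := toBlock_compl_eq_zero_of_preservesSectors_torus hA p hp
  have hX0 := toBlock_compl_eq_zero_of_preservesSectors_torus hX p hp
  have hC0 := toBlock_compl_eq_zero_of_preservesSectors_torus ((hX.mul hA).add ((hA.mul hX).neg)) p hp
  have hsub : X * A - A * X = X * A + -(A * X) := sub_eq_add_neg _ _
  rw [toBlock_sub_self, toBlock_mul_of_toBlock_compl_eq_zero p A _ hA0, hsub,
    toBlock_mul_of_toBlock_compl_eq_zero p _ A hC0, ← hsub, toBlock_sub_self,
    toBlock_mul_of_toBlock_compl_eq_zero p X A hX0, toBlock_mul_of_toBlock_compl_eq_zero p A X hA0]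

omit [NeZero L] in
/-- `hubbardTorusTT'` conserves `N↑, N↓`. [cite: LiebPRL1989, Remark (2)] -/
theorem preservesSectors_hubbardTorusTT' (t t' U : ℝ) : PreservesSectors (hubbardTorusTT' L t t' U) :=
  LiebTwoHoppings.preservesSectors_hamiltonian₂ (fermionTorusGraph 2 L) (fermionTorusDiagGraph L) t t' U

/-- The hook's sector predicate presents the joint sector `(halfRectN n L, halfRectN n L)`.
[cite: LiebPRL1989, proof of Theorem 1] -/
theorem sectorPred_iff_upPart_downPart (n : ℝ) (L : ℕ) (s : Finset (Orb (FermionTorus 2 L))) :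
    (s.card = 2 * ⌊(1 - (1 - n)) * (L : ℝ) ^ 2 / 2⌋₊ ∧
        2 * (s.filter fun i => (ofLex i).2 = 0).card = 2 * ⌊(1 - (1 - n)) * (L : ℝ) ^ 2 / 2⌋₊) ↔
      (upPart s).card = halfRectN n L ∧ (downPart s).card = halfRectN n L :=
  sectorPred_iff_szConfig n L s

/-- **The first thermal moment is local**: for every vector `ψ` of the `t–t′` torus (`L ≥ 9`),
`⟨ψ, (𝒥(H𝒥−𝒥H) − (H𝒥−𝒥H)𝒥) ψ⟩ = L² · torusAvg(d₁)(ψ)`, `d₁ = firstMomentObsTT t′ U` (the commutator of two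
translation sums is the translation sum of the local density `commDensity`). [cite: BratteliRobinsonII1997, Thm. 6.2.4] -/
theorem expect_cur_doubleComm_eq_sq_mul_torusAvg (tp U : ℝ) (hL : 9 ≤ L) (ψ : Fock (Orb (FermionTorus 2 L))) :
    expect (curOpTT' L tp * (hubbardTorusTT' L 1 tp U * curOpTT' L tp - curOpTT' L tp * hubbardTorusTT' L 1 tp U) -
        (hubbardTorusTT' L 1 tp U * curOpTT' L tp - curOpTT' L tp * hubbardTorusTT' L 1 tp U) * curOpTT' L tp) ψ =
      ((L : ℂ) ^ 2) * torusAvgExpectAt L (box 2 4) (firstMomentObsTT tp U) ψ := by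
  have hΩ : Set.InjOn (Torus.proj (d := 2) L) ↑(box 2 4) := injOn_proj_box (by omega)
  have hZ3 : Set.InjOn (Torus.proj (d := 2) L) ↑(box 2 3) := injOn_proj_box (by omega)
  have h14 : box 2 1 ⊆ box 2 4 := box_subset_box (by norm_num)
  have h24 : box 2 2 ⊆ box 2 4 := box_subset_box (by norm_num)
  have h := expect_commutator_sum_relabel_translate L hΩ hZ3 h14 h24
    (fun z hz => by simpa using shiftSet_subset_box_add (subset_refl (box 2 1)) hz)
    (fun a ha c hc => by simpa using sub_mem_box_add ha hc) (curBondObsTT_mem_carEvenSubalgebra tp)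
    (curDerivObsTT tp U) ψ
  rw [← curOpTT'_eq_sum_translate L tp, ← hubbardTorusTT'_commutator_curOpTT' L tp U (by omega)] at h
  exact h

/-- **The third thermal moment is local**: for every vector `ψ` of the `t–t′` torus (`L ≥ 15`), with
`B = H𝒥 − 𝒥H`, `⟨ψ, (B(HB−BH) − (HB−BH)B) ψ⟩ = L² · torusAvg(m₃′)(ψ)`, `m₃′ = thirdMomentObsTT t′ U`.
[cite: BratteliRobinsonII1997, Thm. 6.2.4] -/
theorem expect_comm_doubleComm_eq_sq_mul_torusAvg (tp U : ℝ) (hL : 15 ≤ L) (ψ : Fock (Orb (FermionTorus 2 L))) :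
    expect ((hubbardTorusTT' L 1 tp U * curOpTT' L tp - curOpTT' L tp * hubbardTorusTT' L 1 tp U) *
        (hubbardTorusTT' L 1 tp U *
            (hubbardTorusTT' L 1 tp U * curOpTT' L tp - curOpTT' L tp * hubbardTorusTT' L 1 tp U) -
          (hubbardTorusTT' L 1 tp U * curOpTT' L tp - curOpTT' L tp * hubbardTorusTT' L 1 tp U) *
            hubbardTorusTT' L 1 tp U) -
      (hubbardTorusTT' L 1 tp U *
            (hubbardTorusTT' L 1 tp U * curOpTT' L tp - curOpTT' L tp * hubbardTorusTT' L 1 tp U) -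
          (hubbardTorusTT' L 1 tp U * curOpTT' L tp - curOpTT' L tp * hubbardTorusTT' L 1 tp U) *
            hubbardTorusTT' L 1 tp U) *
        (hubbardTorusTT' L 1 tp U * curOpTT' L tp - curOpTT' L tp * hubbardTorusTT' L 1 tp U)) ψ =
      ((L : ℂ) ^ 2) * torusAvgExpectAt L (box 2 7) (thirdMomentObsTT tp U) ψ := by
  have hΩ : Set.InjOn (Torus.proj (d := 2) L) ↑(box 2 7) := injOn_proj_box (by omega)
  have hZ5 : Set.InjOn (Torus.proj (d := 2) L) ↑(box 2 5) := injOn_proj_box (by omega)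
  have h27 : box 2 2 ⊆ box 2 7 := box_subset_box (by norm_num)
  have h37 : box 2 3 ⊆ box 2 7 := box_subset_box (by norm_num)
  have h := expect_commutator_sum_relabel_translate L hΩ hZ5 h27 h37
    (fun z hz => by simpa using shiftSet_subset_box_add (subset_refl (box 2 2)) hz)
    (fun a ha c hc => by simpa using sub_mem_box_add ha hc) (curDerivObsTT_mem_carEvenSubalgebra tp U)
    (curDeriv2ObsTT tp U) ψ
  rw [← hubbardTorusTT'_commutator_curOpTT' L tp U (by omega),
    ← hubbardTorusTT'_commutator_commutator_curOpTT' L tp U (by omega)] at h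
  exact h

/-- **The fixed-`λ` word of the row as ONE local observable** `a_λ = ½Γk₀ + λΓd₁ − (λ²/2)m₃′ ∈ 𝔄_{[-7,7]²}`
(`Γ` the isotony embeddings into `[-7,7]²`). [cite: Lipparini2008, eq. (8.30)] -/
theorem expect_oddMomentWord_eq (tp U lam : ℝ) (ω : InfVolFermionState 2) :
    (ω.expect (box 2 7) (((1 / 2 : ℝ) : ℂ) • fermionEmbed (PolySite.incl (box_subset_box (by norm_num) : box 2 1 ⊆ box 2 7))
        (kinBondObsTT tp) + ((lam : ℝ) : ℂ) • fermionEmbed (PolySite.incl (box_subset_box (by norm_num) : box 2 4 ⊆ box 2 7))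
        (firstMomentObsTT tp U) - ((lam ^ 2 / 2 : ℝ) : ℂ) • thirdMomentObsTT tp U)).re =
      oddMomentLimitFunctionalTT tp U lam ω := by
  rw [map_sub, map_add, map_smul, map_smul, map_smul, ω.compatible, ω.compatible, oddMomentLimitFunctionalTT,
    smul_eq_mul, smul_eq_mul, smul_eq_mul, Complex.sub_re, Complex.add_re, Complex.re_ofReal_mul,
    Complex.re_ofReal_mul, Complex.re_ofReal_mul]
  ring

/-- The torus average of the fixed-`λ` word is the same combination of the three torus averages (`L ≥ 15`).
[cite: Lipparini2008, eq. (8.30)] -/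
theorem torusAvgExpectAt_oddMomentWord_eq (tp U lam : ℝ) (hL : 15 ≤ L) (ψ : Fock (Orb (FermionTorus 2 L))) :
    torusAvgExpectAt L (box 2 7) (((1 / 2 : ℝ) : ℂ) • fermionEmbed (PolySite.incl (box_subset_box (by norm_num) : box 2 1 ⊆ box 2 7))
        (kinBondObsTT tp) + ((lam : ℝ) : ℂ) • fermionEmbed (PolySite.incl (box_subset_box (by norm_num) : box 2 4 ⊆ box 2 7))
        (firstMomentObsTT tp U) - ((lam ^ 2 / 2 : ℝ) : ℂ) • thirdMomentObsTT tp U) ψ =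
      ((1 / 2 : ℝ) : ℂ) * torusAvgExpectAt L (box 2 1) (kinBondObsTT tp) ψ +
        ((lam : ℝ) : ℂ) * torusAvgExpectAt L (box 2 4) (firstMomentObsTT tp U) ψ -
        ((lam ^ 2 / 2 : ℝ) : ℂ) * torusAvgExpectAt L (box 2 7) (thirdMomentObsTT tp U) ψ := by
  have h7 : Set.InjOn (Torus.proj (d := 2) L) ↑(box 2 7) := injOn_proj_box (by omega)
  -- write the word as a `Fin 3`-indexed linear combination and use linearity of the torus average
  set A : Fin 3 → FermionOp (box 2 7) := ![fermionEmbed (PolySite.incl (box_subset_box (by norm_num) : box 2 1 ⊆ box 2 7))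
      (kinBondObsTT tp), fermionEmbed (PolySite.incl (box_subset_box (by norm_num) : box 2 4 ⊆ box 2 7))
      (firstMomentObsTT tp U), thirdMomentObsTT tp U] with hA
  set c : Fin 3 → ℂ := ![((1 / 2 : ℝ) : ℂ), ((lam : ℝ) : ℂ), -(((lam ^ 2 / 2 : ℝ) : ℂ))] with hc
  have hsum : ((1 / 2 : ℝ) : ℂ) • fermionEmbed (PolySite.incl (box_subset_box (by norm_num) : box 2 1 ⊆ box 2 7))
        (kinBondObsTT tp) + ((lam : ℝ) : ℂ) • fermionEmbed (PolySite.incl (box_subset_box (by norm_num) : box 2 4 ⊆ box 2 7))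
        (firstMomentObsTT tp U) - ((lam ^ 2 / 2 : ℝ) : ℂ) • thirdMomentObsTT tp U = ∑ k ∈ Finset.univ, c k • A k := by
    rw [Fin.sum_univ_three, hA, hc]
    simp only [Matrix.cons_val_zero, Matrix.cons_val_one, Matrix.cons_val_two, Matrix.tail_cons,
      Matrix.head_cons, neg_smul, sub_eq_add_neg]
  rw [hsum, torusAvgExpectAt_sum_smul, Fin.sum_univ_three, hA, hc]
  simp only [Matrix.cons_val_zero, Matrix.cons_val_one, Matrix.cons_val_two, Matrix.tail_cons, Matrix.head_cons]
  rw [torusAvgExpectAt_fermionEmbed_incl L _ h7, torusAvgExpectAt_fermionEmbed_incl L _ h7, neg_mul, sub_eq_add_neg]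

end Blocks

end Summit.Ventures.CertifiedManyBodySolver.Observables
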